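import Literature.MathematicalPhysics.QuantumFieldTheory.Balaban1983to89.B13WalksOfB9Factors
import Literature.MathematicalPhysics.QuantumFieldTheory.Balaban1983to89.B13RealSliceEntryLetters

/-!
# `Balaban1983to89.B13WalksOfB9FactorsRealSlice` — T. Bałaban, *Propagators for lattice gauge theories in a background field*, Commun.
Math. Phys. **99** (1985) 389–434 [Balaban1985BackgroundPropagators] («[13]» of [Balaban1988RG2Cluster]), Thm 3.4 p. 400 (first sentence
and «small perturbations of the operators depending on U only»), (3.24)–(3.27) pp. 394–395 (`G(U) = (Δ_a|Ω₀)⁻¹`), Thm 3.10 (3.107)–(3.108)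
p. 416; *Renormalization group approach to lattice gauge field theories. II*, Commun. Math. Phys. **116** (1988) 1–22 [Balaban1988RG2Cluster]
p. 13 («This construction was discussed in [13] for all operators determining Δ_k»), p. 15 («analytic functions on the spaces (1.13), (1.14)
of [I] with constants α′₀, α′₁ much bigger than α₀, α₁»): THE N06 → N10 OBJECT KNIT AT COMPLEX BACKGROUND — node N06's TYPED LETTERS of
Theorem 3.10 AT EVERY REAL BACKGROUND of the analyticity ball (module 33 `B13WalksOfB9Factors`, real regime) + the [B9] Thm 3.4-SHAPE complex
extension (entrywise holomorphy on the complex ball and, for the inverse road, ONE accretivity margin of the complexified un-inverted operator)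
⟹ the ENTRYWISE (3.108)-letters `RawEntryLetters` of node N10's junction (module 32's binder `hEL`) ON THE COMPLEX CONFIGURATION BALL WITH
GENUINE `u`-DEPENDENCE, by module 38's two-constants transfer (`B13RealSliceEntryLetters`)

statement-level bookkeeping over published theorems with citation tags; kernel-checked compositions of tree theorems; nothing here is a
claim about the Yang–Mills mass gap.

WHY (cell `pub-ymgap`, D-0062 Track A, in-edge N06 = [B9] → N10 = [B13], trigger (t-cplx) of `pub-ymgap-dag-n10-c/HANDOFF.md` §g4 («one file
`B13WalksOfB9FactorsHolo`»); seat `pub-ymgap-dag-n10-c` g5, module 39).  Module 33 knits N06's Thm-3.10 letters (`Ops310`, `Factors389`,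
`Local342G`, `Identities310`, partition ∕ count letters) into N10's entrywise letter for `G(U) = G₀(I − R)⁻¹` AT ONE REAL BACKGROUND, as a
configuration-CONSTANT family; census v5 «LOCATED (currency)»: a `u`-holomorphic family of REAL matrices is constant (module 38
`eq_of_realOps`), so genuine `u`-dependence on the complex `(𝐔, 𝐉)`-ball — [II] p. 15's analyticity in-edge — cannot pass through the
real typing AT complex `u`.  Module 38 (port of ym-nodeO-ideate P2's companion 21) supplies the road that can: real letters ON THE REAL SLICE
of the ball + holomorphy + a rate-free bound on the complex ball ⟹ letters on the shrunken complex ball (Nevanlinna's two constants; rate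
`×(1−λ(r))`, radius `×r∕(1+r)`, constant `B^{1−λ}M^{λ}`), and for INVERTED families the complex-ball half from an accretivity margin.
THIS FILE composes the two BY NAME:
* §1 `map_toMatrix_G_eq_inv` — `Identities310.inv` (`GΔ_a = I`) read as complex matrices: `((M Δ_a).map ofReal)⁻¹ = (M G).map ofReal`
  ([B9] (3.27) `G = (Δ_a|Ω₀)⁻¹`); `B33_nonneg` — module 33's constant is non-negative under its smallness.
* §2 ★ `rawEntryLetters_of_ops310_realSlice` — DIRECT ROAD: a complex family `Δ₀ : E → Matrix X X ℂ` entrywise holomorphic with a rate-free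
  bound `M_b` on the ball `‖u‖ < R_an`, which AT EVERY REAL CONFIGURATION `v` of the ball IS N06's `G(U_v)` read as a complex matrix
  (`hslice`, the dictionary's identification — a hypothesis) for backgrounds `U_v` carrying N06's letters with the SAME constants (print: Thms
  3.1–3.3 ∕ 3.10 uniform over the class (3.35)) ⟹ `RawEntryLetters Δ₀ 𝔬.blk ((r∕(1+r))R_an) ((1−λ(r))κ) (B₃₃^{1−λ}(max B₃₃ M_b)^{λ})`,
  `B₃₃` = module 33's constant `N·B₀η²(m²+1)(1 − q)⁻¹` (module 33 per real background → module 38 `rawEntryLetters_of_realOps`).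
* §3 ★★ `rawEntryLetters_inv_of_ops310_realSlice` — THE [B9] THM 3.4-SHAPED ROAD: a complexified operator family `A : E → Matrix X X ℂ`,
  entrywise holomorphic and `m`-accretive on the complex ball (print: «these analytic extensions as small perturbations of the operators
  depending on U only»; module 38 `accretive_of_coercive_sub` supplies the margin from real coercivity + small complex deviation), which AT
  EVERY REAL CONFIGURATION of the ball IS N06's `Δ_a(U_v)` (`hslice`) ⟹ `RawEntryLetters (u ↦ A(u)⁻¹) 𝔬.blk ((r∕(1+r))R_an) ((1−λ(r))κ)
  (B₃₃^{1−λ}(max B₃₃ (2∕m))^{λ})` — NO (3.108) at complex background, NO rate-free bound supplied by hand: on the real slice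
  `A(v)⁻¹ = G(U_v)` by §1 and module 33's decay, off it module 38 `rawEntryLetters_inv_of_realSlice`.
* §4 `rawEntryLetters_inv_of_ops310_realSlice_radii` — the consumer's radius LITERALLY (module 32's `rf.R`) from inputs on `R_an > 2R₀`,
  rate loss `λ ≤ (4∕π)R₀∕(R_an − R₀)` (module 38 `lam_radii_le`) — print's «much bigger» regime.
What is left at OBJECT level (owners', unchanged, census v5 class A0 ∕ (t-N06-inst)): N06's schemas INHABITED for Bałaban's operators along
the real family `v ↦ U_v`; the complexified `Δ_a(u)` with its holomorphy ((3.50)–(3.53): polynomial in the bond variables) and its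
accretivity margin; the chart's real structure and the identification `hslice` (def-B13's dictionary).

RELATED PRIOR ART IN THE TREE (Summit-side, other currencies; nothing restated).  Cell `pub-balaban`'s NE5 row runs the same two-constants ∕
real-slice mechanism for the OUTPUT RATES of the two-run comparison in the format-weight currency (`T4Continuum/Support/OutputRateComplexSlice*`,
`SubstrateChartRealSlice*`, `InsertionChannelFamilyComplexSlice`, with the necessity witnesses `OutputRateComplexSliceWitness`) and node N19's
`…N19ExpectationCurrencyTwoConstants`; none of them is stated at node N10's entrywise socket `RawEntryLetters` or knits N06's `Ops310` letters, which is
what this file does.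

CONCURRENT MEMO-SIDE TYPING (credit).  Cell `ym-nodeO-ideate`'s lens P2 g33 typed the same two knits memo-side while this file was being
written — companion 22 `pub/ym-nodeO-ideate/memos/ROUTE-P2-files/SketchOps310RealFamily.lean` §7 (sha256
83317b9fc27184dd7f301c1150bd0209768dc473322f7c8eb6d08f73499506d7; T-59.0 `constG_nonneg`, T-59.1 `rawEntryLetters_of_ops310_realFamily`, T-59.2
`rawEntryLetters_inv_of_ops310_realFamily`; farm rc 0 there), offered on the bus 2026-08-27T07:46:45Z with «zero ask, no DEDUP claim»; this file is
the tree author's own typing (statement shapes agree; §4 is added here), not a port.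

HONEST FRAMING.  Count-neutral by-name composition; every N06 schema, the real structure, the identification on the slice, the holomorphy and
the accretivity margin are HYPOTHESES; nothing of Bałaban's operators is constructed or asserted; nodes N06 ∕ N10 NOT discharged; one finite
𝕋⁴ programme at fixed ε — NOT continuum, NOT infinite volume, NOT OS, NOT mass gap, NOT Clay.  0 sorry, 0 `def`, standard axioms.
-/

noncomputable section

namespace Literature.MathematicalPhysics.QuantumFieldTheory.Balaban1983to89.B13WalksOfB9FactorsRealSlice

open Metric Set Finset
open scoped Matrix
open Literature.MathematicalPhysics.QuantumFieldTheory.Balaban1983to89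
open Literature.MathematicalPhysics.QuantumFieldTheory.Balaban1983to89.B9Thm37GlueTorus
open Literature.MathematicalPhysics.QuantumFieldTheory.Balaban1983to89.B5TorusCover (UT)
open Literature.MathematicalPhysics.QuantumFieldTheory.Balaban1983to89.B9Thm310Whole
open Literature.MathematicalPhysics.QuantumFieldTheory.Balaban1983to89.B13EntrywiseWalks (RawEntryLetters)
open Literature.MathematicalPhysics.QuantumFieldTheory.Balaban1983to89.B13WalksOfB9Factors (rawEntryLetters_G_of_ops310)
open Literature.MathematicalPhysics.QuantumFieldTheory.Balaban1983to89.B13RealSliceEntryLetters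
  (RealStructure lam rawEntryLetters_of_realOps rawEntryLetters_inv_of_realSlice lam_radii_le)

variable {X : Type} [Fintype X] [DecidableEq X]
variable {ν : ℕ} {Nf : Fin ν → ℕ} [∀ i, NeZero (Nf i)] {η L M : ℝ}
variable {Bg : B9.Backgrounds} {Y ι A : Type} [Fintype ι] [Fintype A]
variable {E : Type*} [NormedAddCommGroup E] [NormedSpace ℂ E]
variable (𝔬 : Ops310 (torusGeom Nf η L M) Bg X Y ι A) {Rr : ℝ} {H : Prop}

/-! ## §1. `GΔ_a = I` read as complex matrices; the sign of module 33's constant -/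

/-- **[B9] (3.27) `G(U) = (Δ_a)⁻¹` AS COMPLEX MATRICES**: from `Identities310.inv` (`GΔ_a = I` as real endomorphisms),
`((M Δ_a(U)).map ofReal)⁻¹ = (M G(U)).map ofReal` (`M` = `LinearMap.toMatrix'`; `Matrix.inv_eq_left_inv`).
[cite: Balaban1985BackgroundPropagators, (3.27) p.395 and Thm 3.10 p.416] -/
theorem map_toMatrix_G_eq_inv {U : Bg.Cfg} (hI : Identities310 𝔬 Rr H U) :
    ((LinearMap.toMatrix' (𝔬.Δa U)).map (algebraMap ℝ ℂ))⁻¹ = (LinearMap.toMatrix' (𝔬.G U)).map (algebraMap ℝ ℂ) := by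
  refine Matrix.inv_eq_left_inv ?_
  rw [← Matrix.map_mul, ← LinearMap.toMatrix'_mul, hI.inv, LinearMap.toMatrix'_one]
  exact Matrix.map_one _ (map_zero _) (map_one _)

omit [Fintype X] [DecidableEq X] [∀ i, NeZero (Nf i)] in
/-- Module 33's constant `N·B₀η²·(m²+1)·(1 − q)⁻¹` is non-negative under its smallness `q < 1` (`N, B₀ ≥ 0`).
[cite: Balaban1985BackgroundPropagators, Thm 3.10 (3.108) p.416] (elementary API for (3.108)) -/
theorem B33_nonneg {θ₀ B₀ N NF : ℝ} (hB₀ : 0 ≤ B₀) (hN : 0 ≤ N) {m : ℕ} {μ : ℝ}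
    (hq : (m * B6.c0 1 μ ^ ν) * ((NF * (θ₀ * M⁻¹)) * (m * m + 1)) * B6.c0 1 μ ^ ν < 1) :
    0 ≤ (N * (B₀ * η ^ 2)) * (m * m + 1) *
      (1 - (m * B6.c0 1 μ ^ ν) * ((NF * (θ₀ * M⁻¹)) * (m * m + 1)) * B6.c0 1 μ ^ ν)⁻¹ :=
  mul_nonneg (by positivity) (inv_nonneg.2 (by linarith))

/-! ## §2. The direct road: N06's letters at every real background + holomorphy and a rate-free bound on the complex ball -/

/-- **THE N06 → N10 KNIT AT COMPLEX BACKGROUND, DIRECT ROAD.**  A real structure `ℛ` on the configuration space `E`; a complex family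
`Δ₀ : E → Matrix X X ℂ` entrywise holomorphic on the ball `‖u‖ < R_an` with a rate-free bound `‖Δ₀(u)_{xx′}‖ ≤ M_b` there; a background
`U_v` read at every configuration; AT EVERY REAL `v` of the ball: node N06's typed letters of Theorem 3.10 for `U_v` with the SAME constants
(`Factors389`, `Local342G`, `Identities310`; the v-free partition ∕ count letters `|h_□| ≤ 1`, `supp h_□ ⊂ S_□`, `N`, `N_F`; the fibre bound
`m` of the block map; the rate window `κ + 2μ ≤ ρ − ε`, `ρ + μ ≤ δ₀`; «M sufficiently large» `q < 1`) and the identification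
`Δ₀ v = (M G(U_v)).map ofReal` (the dictionary's, a hypothesis).  Then for every `0 < r < 1`, `Δ₀` is a `RawEntryLetters` datum — the binder
`hEL` of node N10's entrywise junction edition — on the ball `‖u‖ < (r∕(1+r))R_an` with rate `(1−λ(r))κ` and constant `B₃₃^{1−λ(r)}(max B₃₃ M_b)^{λ(r)}`,
`B₃₃ = N·B₀η²(m²+1)(1 − q)⁻¹`: module 33 `rawEntryLetters_G_of_ops310` at each real `v`, then module 38 `rawEntryLetters_of_realOps`.
[cite: Balaban1985BackgroundPropagators, Thm 3.4 p.400, Thm 3.10 (3.107)–(3.108) p.416; Balaban1988RG2Cluster, p.13, p.15; Ransford1995, Thm. 4.3.7] -/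
theorem rawEntryLetters_of_ops310_realSlice (ℛ : RealStructure E) {Δ₀ : E → Matrix X X ℂ} (Uv : E → Bg.Cfg)
    {Ran Mb r θ₀ δ₀ B₀ N NF : ℝ}
    (hF : ∀ v ∈ ℛ.Ereal, ‖v‖ < Ran → Factors389 𝔬 Rr H θ₀ δ₀ (Uv v))
    (hG0 : ∀ v ∈ ℛ.Ereal, ‖v‖ < Ran → Local342G 𝔬 Rr H B₀ δ₀ (Uv v))
    (hI : ∀ v ∈ ℛ.Ereal, ‖v‖ < Ran → Identities310 𝔬 Rr H (Uv v))
    (hh : ∀ i x, |𝔬.h i x| ≤ 1) (hS : ∀ i x, 𝔬.h i x ≠ 0 → 𝔬.blk x ∈ 𝔬.S i)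
    (hcnt : ∀ s : UT Nf, (∑ i, if s ∈ 𝔬.S i then (1 : ℝ) else 0) ≤ N)
    (hcntF : ∀ s : UT Nf, (∑ a, if s ∈ 𝔬.SF a then (1 : ℝ) else 0) ≤ NF)
    (hθ₀ : 0 ≤ θ₀ * M⁻¹) (hB₀ : 0 ≤ B₀) (hN : 0 ≤ N) (hNF : 0 ≤ NF) [Nonempty (UT Nf)] (c : B13.Consts)
    {m : ℕ} (hfib : ∀ y : UT Nf, (Finset.univ.filter fun k => 𝔬.blk k = y).card ≤ m)
    {ρ ε κ μ : ℝ} (hμ : 0 < μ) (hε : 0 ≤ ε) (hκ : 0 ≤ κ) (hwin : κ + 2 * μ ≤ ρ - ε) (hρδ : ρ + μ ≤ δ₀)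
    (hq : (m * B6.c0 1 μ ^ ν) * ((NF * (θ₀ * M⁻¹)) * (m * m + 1)) * B6.c0 1 μ ^ ν < 1)
    -- the complex family on the ball: identification on the real slice, holomorphy, a rate-free bound
    (hslice : ∀ v ∈ ℛ.Ereal, ‖v‖ < Ran → Δ₀ v = (LinearMap.toMatrix' (𝔬.G (Uv v))).map (algebraMap ℝ ℂ))
    (hholo : ∀ i j, DifferentiableOn ℂ (fun u => Δ₀ u i j) (ball (0 : E) Ran))
    (hMb : ∀ u ∈ ball (0 : E) Ran, ∀ i j, ‖Δ₀ u i j‖ ≤ Mb) (hr0 : 0 < r) (hr1 : r < 1) :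
    RawEntryLetters Δ₀ 𝔬.blk (r / (1 + r) * Ran) ((1 - lam r) * κ)
      (((N * (B₀ * η ^ 2)) * (m * m + 1) *
          (1 - (m * B6.c0 1 μ ^ ν) * ((NF * (θ₀ * M⁻¹)) * (m * m + 1)) * B6.c0 1 μ ^ ν)⁻¹) ^ (1 - lam r) *
        (max ((N * (B₀ * η ^ 2)) * (m * m + 1) *
            (1 - (m * B6.c0 1 μ ^ ν) * ((NF * (θ₀ * M⁻¹)) * (m * m + 1)) * B6.c0 1 μ ^ ν)⁻¹) Mb) ^ lam r) := by
  have hB0 := B33_nonneg (ν := ν) (η := η) hB₀ hN hq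
  exact rawEntryLetters_of_realOps ℛ (fun v => LinearMap.toMatrix' (𝔬.G (Uv v))) one_pos hslice
    (fun v hv hvR => rawEntryLetters_G_of_ops310 (E := E) 𝔬 (hF v hv hvR) (hG0 v hv hvR) (hI v hv hvR) hh hS hcnt hcntF
      hθ₀ hB₀ hN hNF c hfib hμ hε hκ hwin hρδ hq 1)
    hholo (fun u hu i j => (hMb u hu i j).trans (le_max_right _ _)) hB0 (le_max_left _ _) hκ hr0 hr1

/-! ## §3. The [B9] Thm 3.4-shaped road: a holomorphic accretive complexification of `Δ_a` whose real slice is N06's -/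

/-- **THE N06 → N10 KNIT AT COMPLEX BACKGROUND, [B9] THM 3.4-SHAPED ROAD.**  A real structure `ℛ` on `E`; a complexified operator family
`A : E → Matrix X X ℂ`, entrywise holomorphic on the ball `‖u‖ < R_an` (Thm 3.4 first sentence: «can be extended to analytic functions»;
for `Δ′_a`, `Δ_a` of (3.24), (3.26): polynomial in the bond variables, (3.50)–(3.53)) and `m`-accretive there with ONE margin `m > 0`
(«small perturbations of the operators depending on U only»; module 38 `accretive_of_coercive_sub`), which AT EVERY REAL `v` of the ball
IS N06's `Δ_a(U_v)` read as a complex matrix (`hslice`); N06's Thm-3.10 letters at every such `U_v` as in §2.  Then for every `0 < r < 1`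
the INVERSE family `u ↦ A(u)⁻¹` — print's `G(U) = (Δ_a|Ω₀)⁻¹` continued to complex background — is a `RawEntryLetters` datum on
`‖u‖ < (r∕(1+r))R_an` with rate `(1−λ(r))κ` and constant `B₃₃^{1−λ(r)}(max B₃₃ (2∕m))^{λ(r)}`: on the real slice `A(v)⁻¹ = G(U_v)` (§1) carries
module 33's decay, on the complex ball holomorphy and the bound `2∕m` of the inverse come from accretivity
(module 38 `rawEntryLetters_inv_of_realSlice`).  No (3.108) at complex background and no rate-free bound is supplied by hand.
[cite: Balaban1985BackgroundPropagators, (3.24)–(3.27) pp.394–395, Thm 3.4 p.400, (3.50)–(3.53) p.400, Thm 3.10 (3.108) p.416;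
Balaban1988RG2Cluster, p.13, p.15; Ransford1995, Thm. 4.3.7] -/
theorem rawEntryLetters_inv_of_ops310_realSlice (ℛ : RealStructure E) {Aop : E → Matrix X X ℂ} (Uv : E → Bg.Cfg)
    {Ran mA r θ₀ δ₀ B₀ N NF : ℝ}
    (hF : ∀ v ∈ ℛ.Ereal, ‖v‖ < Ran → Factors389 𝔬 Rr H θ₀ δ₀ (Uv v))
    (hG0 : ∀ v ∈ ℛ.Ereal, ‖v‖ < Ran → Local342G 𝔬 Rr H B₀ δ₀ (Uv v))
    (hI : ∀ v ∈ ℛ.Ereal, ‖v‖ < Ran → Identities310 𝔬 Rr H (Uv v))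
    (hh : ∀ i x, |𝔬.h i x| ≤ 1) (hS : ∀ i x, 𝔬.h i x ≠ 0 → 𝔬.blk x ∈ 𝔬.S i)
    (hcnt : ∀ s : UT Nf, (∑ i, if s ∈ 𝔬.S i then (1 : ℝ) else 0) ≤ N)
    (hcntF : ∀ s : UT Nf, (∑ a, if s ∈ 𝔬.SF a then (1 : ℝ) else 0) ≤ NF)
    (hθ₀ : 0 ≤ θ₀ * M⁻¹) (hB₀ : 0 ≤ B₀) (hN : 0 ≤ N) (hNF : 0 ≤ NF) [Nonempty (UT Nf)] (c : B13.Consts)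
    {m : ℕ} (hfib : ∀ y : UT Nf, (Finset.univ.filter fun k => 𝔬.blk k = y).card ≤ m)
    {ρ ε κ μ : ℝ} (hμ : 0 < μ) (hε : 0 ≤ ε) (hκ : 0 ≤ κ) (hwin : κ + 2 * μ ≤ ρ - ε) (hρδ : ρ + μ ≤ δ₀)
    (hq : (m * B6.c0 1 μ ^ ν) * ((NF * (θ₀ * M⁻¹)) * (m * m + 1)) * B6.c0 1 μ ^ ν < 1)
    -- the complexified Δ_a on the ball: identification on the real slice, holomorphy, one accretivity margin
    (hslice : ∀ v ∈ ℛ.Ereal, ‖v‖ < Ran → Aop v = (LinearMap.toMatrix' (𝔬.Δa (Uv v))).map (algebraMap ℝ ℂ))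
    (hA : ∀ i j, DifferentiableOn ℂ (fun u => Aop u i j) (ball (0 : E) Ran)) (hmA : 0 < mA)
    (hacc : ∀ u ∈ ball (0 : E) Ran, ∀ w : X → ℂ, mA * ∑ i, ‖w i‖ ^ 2 ≤ (∑ i, star (w i) * (Aop u *ᵥ w) i).re)
    (hr0 : 0 < r) (hr1 : r < 1) :
    RawEntryLetters (fun u => (Aop u)⁻¹) 𝔬.blk (r / (1 + r) * Ran) ((1 - lam r) * κ)
      (((N * (B₀ * η ^ 2)) * (m * m + 1) *
          (1 - (m * B6.c0 1 μ ^ ν) * ((NF * (θ₀ * M⁻¹)) * (m * m + 1)) * B6.c0 1 μ ^ ν)⁻¹) ^ (1 - lam r) *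
        (max ((N * (B₀ * η ^ 2)) * (m * m + 1) *
            (1 - (m * B6.c0 1 μ ^ ν) * ((NF * (θ₀ * M⁻¹)) * (m * m + 1)) * B6.c0 1 μ ^ ν)⁻¹) (2 / mA)) ^ lam r) := by
  have hB0 := B33_nonneg (ν := ν) (η := η) hB₀ hN hq
  refine rawEntryLetters_inv_of_realSlice ℛ hmA hA hacc (fun v hv hvR i j => ?_) hB0 hκ hr0 hr1
  -- on the real slice the inverse IS N06's G(U_v), which carries module 33's decay at every point of its ball
  rw [hslice v hv hvR, map_toMatrix_G_eq_inv 𝔬 (hI v hv hvR)]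
  exact (rawEntryLetters_G_of_ops310 (E := E) 𝔬 (hF v hv hvR) (hG0 v hv hvR) (hI v hv hvR) hh hS hcnt hcntF hθ₀ hB₀ hN
    hNF c hfib hμ hε hκ hwin hρδ hq 1).decay 0 (mem_ball_self one_pos) i j

/-! ## §4. The radii edition: the consumer's radius literally, print's «much bigger» regime -/

/-- **RADII EDITION OF §3**: for a target radius `R₀ > 0` (module 32's `rf.R`) and an analyticity radius `R_an > 2R₀` ([II] p.15: the
primed spaces are «much bigger»), §3 at `r := R₀∕(R_an − R₀)` gives the letters ON THE BALL OF RADIUS `R₀` with rate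
`(1 − λ(R₀∕(R_an−R₀)))κ`, where `λ(R₀∕(R_an−R₀)) ≤ (4∕π)·R₀∕(R_an−R₀)` (module 38 `lam_radii_le`) — the rate loss vanishes as `R₀∕R_an → 0`.
[cite: Balaban1985BackgroundPropagators, Thm 3.4 p.400, Thm 3.10 (3.108) p.416; Balaban1988RG2Cluster, p.15; Balaban1987RG1, (1.13)–(1.14) p.262; Ransford1995, Thm. 4.3.7] -/
theorem rawEntryLetters_inv_of_ops310_realSlice_radii (ℛ : RealStructure E) {Aop : E → Matrix X X ℂ} (Uv : E → Bg.Cfg)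
    {Ran R₀ mA θ₀ δ₀ B₀ N NF : ℝ} (hR₀ : 0 < R₀) (h2 : 2 * R₀ < Ran)
    (hF : ∀ v ∈ ℛ.Ereal, ‖v‖ < Ran → Factors389 𝔬 Rr H θ₀ δ₀ (Uv v))
    (hG0 : ∀ v ∈ ℛ.Ereal, ‖v‖ < Ran → Local342G 𝔬 Rr H B₀ δ₀ (Uv v))
    (hI : ∀ v ∈ ℛ.Ereal, ‖v‖ < Ran → Identities310 𝔬 Rr H (Uv v))
    (hh : ∀ i x, |𝔬.h i x| ≤ 1) (hS : ∀ i x, 𝔬.h i x ≠ 0 → 𝔬.blk x ∈ 𝔬.S i)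
    (hcnt : ∀ s : UT Nf, (∑ i, if s ∈ 𝔬.S i then (1 : ℝ) else 0) ≤ N)
    (hcntF : ∀ s : UT Nf, (∑ a, if s ∈ 𝔬.SF a then (1 : ℝ) else 0) ≤ NF)
    (hθ₀ : 0 ≤ θ₀ * M⁻¹) (hB₀ : 0 ≤ B₀) (hN : 0 ≤ N) (hNF : 0 ≤ NF) [Nonempty (UT Nf)] (c : B13.Consts)
    {m : ℕ} (hfib : ∀ y : UT Nf, (Finset.univ.filter fun k => 𝔬.blk k = y).card ≤ m)
    {ρ ε κ μ : ℝ} (hμ : 0 < μ) (hε : 0 ≤ ε) (hκ : 0 ≤ κ) (hwin : κ + 2 * μ ≤ ρ - ε) (hρδ : ρ + μ ≤ δ₀)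
    (hq : (m * B6.c0 1 μ ^ ν) * ((NF * (θ₀ * M⁻¹)) * (m * m + 1)) * B6.c0 1 μ ^ ν < 1)
    (hslice : ∀ v ∈ ℛ.Ereal, ‖v‖ < Ran → Aop v = (LinearMap.toMatrix' (𝔬.Δa (Uv v))).map (algebraMap ℝ ℂ))
    (hA : ∀ i j, DifferentiableOn ℂ (fun u => Aop u i j) (ball (0 : E) Ran)) (hmA : 0 < mA)
    (hacc : ∀ u ∈ ball (0 : E) Ran, ∀ w : X → ℂ, mA * ∑ i, ‖w i‖ ^ 2 ≤ (∑ i, star (w i) * (Aop u *ᵥ w) i).re) :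
    RawEntryLetters (fun u => (Aop u)⁻¹) 𝔬.blk R₀ ((1 - lam (R₀ / (Ran - R₀))) * κ)
      (((N * (B₀ * η ^ 2)) * (m * m + 1) *
          (1 - (m * B6.c0 1 μ ^ ν) * ((NF * (θ₀ * M⁻¹)) * (m * m + 1)) * B6.c0 1 μ ^ ν)⁻¹) ^ (1 - lam (R₀ / (Ran - R₀))) *
        (max ((N * (B₀ * η ^ 2)) * (m * m + 1) *
            (1 - (m * B6.c0 1 μ ^ ν) * ((NF * (θ₀ * M⁻¹)) * (m * m + 1)) * B6.c0 1 μ ^ ν)⁻¹) (2 / mA)) ^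
          lam (R₀ / (Ran - R₀))) ∧
      lam (R₀ / (Ran - R₀)) ≤ 4 / Real.pi * (R₀ / (Ran - R₀)) := by
  have hd : 0 < Ran - R₀ := by linarith
  have hr0 : 0 < R₀ / (Ran - R₀) := div_pos hR₀ hd
  have hr1 : R₀ / (Ran - R₀) < 1 := (div_lt_one hd).2 (by linarith)
  have h := rawEntryLetters_inv_of_ops310_realSlice 𝔬 ℛ Uv hF hG0 hI hh hS hcnt hcntF hθ₀ hB₀ hN hNF c hfib hμ hε hκ hwin hρδ
    hq hslice hA hmA hacc hr0 hr1
  have e : R₀ / (Ran - R₀) / (1 + R₀ / (Ran - R₀)) * Ran = R₀ := by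
    field_simp
    ring
  rw [e] at h
  exact ⟨h, lam_radii_le hR₀.le h2⟩

end Literature.MathematicalPhysics.QuantumFieldTheory.Balaban1983to89.B13WalksOfB9FactorsRealSlice

end
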